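/-
COR-CM (cells pub-hodgecm / pub-hodgecm2, Hodge ladder stage 2) — TRANSPOSITION item (vi), sub-binder S2 `supply`; the CM side of the
PINNED junction (`Transposition/Item6SupplyPinned.lean`, own-htheta g3; binders `hμ`, `hCM`) AT LIU'S OWN OBJECTS, as DEFINITIONS over
an arbitrary datum family `D : ∀ F ι₁ V Φ, Thm418Data F⁺ F` of [Liu 2021, Thm. 4.18] AS PRINTED, plus the two theorems the pins consume.
Written by the stage-1 binder seat pub-hodgecm-mc-binder-1 (gen 22, prover-pub-hodgecm-mc-binder-1-g22-0), count-neutral lane; the three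
definitions are the INTENDED INSTANTIATION of the junction's pin `Aμ` (D-0009 reviewed); nothing under `CorCM/B01/` is edited, restated
or imported.  HC_CM is NOT proved.
-/
import Summits.HodgeConjecture.CorCM.LiuValueFieldPin
import Literature.NumberTheory.Automorphic.Liu2021.Thm418ValueField
import HarnessLib

/-!
# The Liu pin `Aμ := A_{(M_μ, Ψ̃_μ)}` as a definition, and (hCM) ∕ CM-side reach for it — for every datum family

For the pinned junction `Model.faceSupply_of_thm418AsPrinted_pinned (D) (Aμ) (hLiu) … (hμ) (hCM) (hReach)` the consumer must SUPPLY the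
pin `Aμ : ∀ (F : CMField) (ι₁ : F →+* ℂ) (V : HermSpace3 F ι₁) (Φ : CMType F), (D F ι₁ V Φ).Obj → AbelianVariety ℂ` as a term.  This
file defines the honest one ([Liu2021] Def. 4.5 (2) + Def. 4.3 (2): `A_μ ⊗_{E,ι₁} ℂ` has CM by `M_μ` with type `Ψ̃_μ = (Φ_μ*)^{M_μ}`):

* `Model.liuValueCMField F hψ : CMField` (an `abbrev`) — Liu's `M_μ = muAlgValueField F ψ` bundled (instances
  `IsConjugateSymplectic.numberField_muAlgValueField` ∕ `.isCMField_muAlgValueField`, `Literature/…/IdeleClassCharacterValueFieldCM.lean`);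
* `Model.liuPinEmb F ι₁ Θ hψ hT : K* →+* M_μ` — the inclusion `M'_μ ⊆ M_μ` at the tree's reflex field `K* = reflexField ℚ F (algValuedIn ι₁ Θ)`
  (`k ↦ ι₁ k`; needs `F` Galois and `HasCMType F ψ Θ`);
* `Model.liuPinAV h₃ F ι₁ Θ hψ hT : AbelianVariety ℂ` — `A_{(M_μ, Ψ̃_μ)} := (cmRealisation h₃ (cmCode (liuValueCMField F hψ) (inducedCMType (liuPinEmb …)
  (reflexCMType ι₁ Θ id)))).AV`, the tree's own CM abelian variety of that type (≃ Liu's `A_μ ⊗_{E,ι₁} ℂ` up to isogeny);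
* `Model.liuPinFamily h₃ D : ∀ F ι₁ V Φ, (D F ι₁ V Φ).Obj → AbelianVariety ℂ` — the junction-shaped pin: at a Galois `F` it is
  `liuPinAV` for `ψ := (D F ι₁ V Φ).μ`, `Θ := (D F ι₁ V Φ).cmType = Φ_μ` (`Thm418Data.hasCMType_cmType`); at a non-Galois `F` (never consumed by
  the junction, whose binders are all guarded by `IsGalois ℚ F`) it is the harmless default `A_{(F,Φ)}`.

Theorems (what pin-2 ∕ pin-3 cite):
* `Model.hCM_liuPinFamily h₃ D` — **the junction's (hCM) binder, VERBATIM in its ∀-guarded ∃-shape, HOLDS for `Aμ := liuPinFamily h₃ D`**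
  (for EVERY datum family `D`; no hypothesis): witnesses `M := M_μ`, `e := liuPinEmb`, realisation by `isCMTypeRealisation_cmCode_read`.
* `Model.exists_hom_cmAV_ne_zero_of_hom_liuPinFamily` — **CM-side reach**: under the junction's (hμ) clause at `(F, ι₁, V, Φ)` (the datum's
  `Φ_μ` is the inverse type of `Φ` through `ι₁`), every non-zero `u : X ⟶ liuPinFamily h₃ D F ι₁ V Φ Dμ` (e.g. (hReach)'s `w : 𝒥.J ⟶ Aμ …`)
  yields a non-zero `X ⟶ A_{(F,Φ)} = (cmRealisation h₃ (cmCode F Φ)).AV` (binder-1 g21 `exists_hom_cmAV_ne_zero_of_reach_cmCode_reflex`).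
So with this pin the junction's CM side carries NO posited content: (hCM) is a theorem outright, (hμ) is the consumer's CHOICE of `μ`
(dischargeable per `(F, ι₁, Φ)` by `exists_isConjugateSymplectic_hasCMType (Transposition.invType ι₁ Φ)` + `IsConjugateSymplectic.cmType_eq`),
and the residual of S2 on the object-match line is (hReach) alone.  HC_CM is NOT proved.

References: Y. Liu, *Fourier–Jacobi cycles and arithmetic relative trace formula*, Camb. J. Math. 9 (2021) = arXiv:2102.11518, §4.1 (TeX
ll. 1922–1928), Def. 4.3 (2) (l. 1919), Def. 4.5 (2) (ll. 1944–1951); G. Shimura, *Abelian Varieties with Complex Multiplication and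
Modular Functions* (1998) §5.2, §6.2 Thm. 3, §8.3 Prop. 28.
-/

noncomputable section

namespace Summit.HodgeConjecture.CorCM.Model

open CategoryTheory NumberField
open Literature.AlgebraicGeometry.Motives
open Literature.NumberTheory.ComplexMultiplication
open Literature.NumberTheory.Automorphic
open Literature.NumberTheory.Automorphic.IdeleClassGroup
open Literature.NumberTheory.Automorphic.Liu2021
open Literature.NumberTheory.Automorphic.PicardCM (cmRealisation CMAbelianVarietyRealised)
open Literature.AlgebraicGeometry.HodgeTheory (complexBetti)
open Literature.AlgebraicGeometry.ComplexMultiplication (IsCMTypeRealisation)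

/-! ## The pin at one `(F, ι₁, Θ, ψ)` -/

section OnePin

/-- **Liu's `M_μ` as a bundled CM field**: `⟨muAlgValueField F ψ⟩` with the instances `NumberField` ∕ `IsCMField` of
`IdeleClassCharacterValueFieldCM.lean` ([Liu2021] §4.1 "`M_μ` … is a number field"; CM by §18.2 of Shimura 1998).
[cite: Liu2021, §4.1 (TeX ll. 1926–1928)] -/
abbrev liuValueCMField (F : CMField) {ψ : IdeleClassGroup F →ₜ* Circle} (hψ : IsConjugateSymplectic F ψ) : CMField :=
  letI : NumberField (muAlgValueField F ψ) := hψ.numberField_muAlgValueField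
  letI : IsCMField (muAlgValueField F ψ) := hψ.isCMField_muAlgValueField
  CMField.mk (muAlgValueField F ψ)

/-- The carrier of `liuValueCMField F hψ` is `M_μ` (by `rfl`). [folklore] -/
@[simp] theorem liuValueCMField_K (F : CMField) {ψ : IdeleClassGroup F →ₜ* Circle} (hψ : IsConjugateSymplectic F ψ) :
    (liuValueCMField F hψ).K = muAlgValueField F ψ := rfl

/-- **`e_μ : K* → M_μ`, `k ↦ ι₁(k)`** — Liu's inclusion `M'_μ ⊆ M_μ` ([Liu2021] §4.1, l. 1928) at the tree's reflex field
`K* = reflexField ℚ F (algValuedIn ι₁ Θ) ⊆ F` of `(F, Θ = Φ_μ)` (`ι₁(K*) = traceField Θ ⊆ M_μ`, `apply_mem_muAlgValueField_of_mem_reflexField`).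
[cite: Liu2021, §4.1 (TeX l. 1928) and Def. 4.3 (2)] -/
def liuPinEmb (F : CMField) [IsGalois ℚ F] (ι₁ : F →+* ℂ) (Θ : CMType F)
    {ψ : IdeleClassGroup F →ₜ* Circle} (hψ : IsConjugateSymplectic F ψ) (hT : HasCMType F ψ Θ) :
    reflexField ℚ F (algValuedIn ι₁ Θ.1) →+* muAlgValueField F ψ :=
  (ι₁.comp (reflexField ℚ F (algValuedIn ι₁ Θ.1)).val.toRingHom).codRestrict (muAlgValueField F ψ)
    fun k => apply_mem_muAlgValueField_of_mem_reflexField F ι₁ Θ hψ hT k.2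

/-- `(e_μ k : ℂ) = ι₁ k`. [cite: Liu2021, §4.1 (TeX l. 1928)] -/
@[simp] theorem coe_liuPinEmb_apply (F : CMField) [IsGalois ℚ F] (ι₁ : F →+* ℂ) (Θ : CMType F)
    {ψ : IdeleClassGroup F →ₜ* Circle} (hψ : IsConjugateSymplectic F ψ) (hT : HasCMType F ψ Θ)
    (k : reflexField ℚ F (algValuedIn ι₁ Θ.1)) :
    ((liuPinEmb F ι₁ Θ hψ hT k : muAlgValueField F ψ) : ℂ) = ι₁ k := rfl

/-- **THE LIU PIN `A_{(M_μ, Ψ̃_μ)}`**: the tree's own CM abelian variety (`cmRealisation h₃`, [Shimura1998] §5.2 / §6.2 Thm. 3) of the CM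
type `Ψ̃_μ = (Θ*)^{M_μ} = inducedCMType e_μ (reflexCMType ι₁ Θ id)` of `M_μ` — the type of Liu's `A_μ ⊗_{E,ι₁} ℂ` over `M_μ` by
[Liu2021] Def. 4.5 (2) + Def. 4.3 (2) (tree `Liu2021.LiuCMData.cmType_eq_induced_of_det45`). [cite: Liu2021, Def. 4.5 (2) and Def. 4.3 (2)] -/
def liuPinAV (h₃ : CMAbelianVarietyRealised) (F : CMField) [IsGalois ℚ F] (ι₁ : F →+* ℂ) (Θ : CMType F)
    {ψ : IdeleClassGroup F →ₜ* Circle} (hψ : IsConjugateSymplectic F ψ) (hT : HasCMType F ψ Θ) : AbelianVariety ℂ :=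
  (cmRealisation h₃ (cmCode (liuValueCMField F hψ)
    (inducedCMType (liuPinEmb F ι₁ Θ hψ hT) (reflexCMType ι₁ Θ (AlgHom.id ℚ F))))).AV

/-- **(hCM) at the Liu pin**: `A_{(M_μ, Ψ̃_μ)}` realises `Ψ̃_μ` on `H¹` (the chosen realisation read over the bundled field,
`isCMTypeRealisation_cmCode_read`). [cite: Liu2021, Def. 4.5 (2)] [cite: Shimura1998, §5.2 and §6.2 Theorem 3] -/
theorem exists_isCMTypeRealisation_liuPinAV (h₃ : CMAbelianVarietyRealised) (F : CMField) [IsGalois ℚ F] (ι₁ : F →+* ℂ) (Θ : CMType F)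
    {ψ : IdeleClassGroup F →ₜ* Circle} (hψ : IsConjugateSymplectic F ψ) (hT : HasCMType F ψ Θ) :
    haveI := hψ.numberField_muAlgValueField
    haveI := hψ.isCMField_muAlgValueField
    ∃ (ιB : 𝓞 (muAlgValueField F ψ) →+* End (liuPinAV h₃ F ι₁ Θ hψ hT))
      (θB : muAlgValueField F ψ →+* Module.End ℂ (complexBetti (liuPinAV h₃ F ι₁ Θ hψ hT).X 1)),
      IsCMTypeRealisation (inducedCMType (liuPinEmb F ι₁ Θ hψ hT) (reflexCMType ι₁ Θ (AlgHom.id ℚ F)))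
        (liuPinAV h₃ F ι₁ Θ hψ hT) ιB θB :=
  ⟨_, _, isCMTypeRealisation_cmCode_read h₃ (liuValueCMField F hψ)
    (inducedCMType (liuPinEmb F ι₁ Θ hψ hT) (reflexCMType ι₁ Θ (AlgHom.id ℚ F)))⟩

/-- **CM-side reach at the Liu pin**: for `Θ = Φ^{*ι₁}` (inverse type), every non-zero `u : X ⟶ A_{(M_μ, Ψ̃_μ)}` yields a non-zero
`X ⟶ A_{(F,Φ)}` (binder-1 g21 `exists_hom_cmAV_ne_zero_of_reach_cmCode_reflex`: Shimura §6.2 Thm. 3 + §6.1 Cor. over Riemann, and the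
Galois identity "the reflex pair of `Φ^{*ι₁}` induces `Φ`"). [cite: Shimura1998, §6.2 Theorem 3 and §8.3 Prop. 28] [cite: Liu2021, Def. 4.5 (2)] -/
theorem exists_hom_cmAV_ne_zero_of_hom_liuPinAV (h₃ : CMAbelianVarietyRealised) (F : CMField) [IsGalois ℚ F] (ι₁ : F →+* ℂ) (Θ : CMType F)
    {ψ : IdeleClassGroup F →ₜ* Circle} (hψ : IsConjugateSymplectic F ψ) (hT : HasCMType F ψ Θ) {Φ : CMType F}
    (hΘ : ∀ g : F ≃ₐ[ℚ] F, ι₁.comp (g : F →+* F) ∈ Θ.1 ↔ ι₁.comp (g.symm : F →+* F) ∈ Φ.1)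
    {X : AbelianVariety ℂ} {u : X ⟶ liuPinAV h₃ F ι₁ Θ hψ hT} (hu : u ≠ 0) :
    ∃ v : X ⟶ (cmRealisation h₃ (cmCode F Φ)).AV, v ≠ 0 :=
  exists_hom_cmAV_ne_zero_of_reach_cmCode_reflex h₃ F ι₁ hΘ (liuValueCMField F hψ) (liuPinEmb F ι₁ Θ hψ hT) hu

end OnePin

/-! ## The junction-shaped pin over a datum family of [Liu 2021, Thm. 4.18] AS PRINTED -/

section Family


/-- **The Liu pin as the junction's `Aμ`**: at `(F, ι₁, V, Φ)` and any object `Dμ`, the CM abelian variety `A_{(M_μ, Ψ̃_μ)}` of the DATUM'S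
character `μ := (D F ι₁ V Φ).μ` (conjugate symplectic of weight one, `Thm418Data.isConjugateSymplectic`) and its CM type `Φ_μ := (D F ι₁ V Φ).cmType`
(`Thm418Data.hasCMType_cmType`), when `F` is Galois; the default `A_{(F,Φ)}` otherwise (the junction only consumes Galois `F`).
[cite: Liu2021, Def. 4.5 (2) and Def. 4.3 (2)] -/
def liuPinFamily (h₃ : CMAbelianVarietyRealised)
    (D : ∀ (F : CMField) (ι₁ : F →+* ℂ) (_ : HermSpace3 F ι₁) (_ : CMType F), Thm418Data (maximalRealSubfield F) F) :
    ∀ (F : CMField) (ι₁ : F →+* ℂ) (V : HermSpace3 F ι₁) (Φ : CMType F), (D F ι₁ V Φ).Obj → AbelianVariety ℂ :=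
  fun F ι₁ V Φ _ => by
    classical
    exact if hG : IsGalois ℚ F then
      @liuPinAV h₃ F hG ι₁ (D F ι₁ V Φ).cmType (D F ι₁ V Φ).μ (D F ι₁ V Φ).isConjugateSymplectic
        (Thm418Data.hasCMType_cmType (D F ι₁ V Φ))
    else (cmRealisation h₃ (cmCode F Φ)).AV

/-- At a Galois `F` the family pin IS `liuPinAV` of the datum's `(μ, Φ_μ)`. [cite: Liu2021, Def. 4.5 (2)] -/
theorem liuPinFamily_eq (h₃ : CMAbelianVarietyRealised)
    (D : ∀ (F : CMField) (ι₁ : F →+* ℂ) (_ : HermSpace3 F ι₁) (_ : CMType F), Thm418Data (maximalRealSubfield F) F)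
    (F : CMField) [hG : IsGalois ℚ F] (ι₁ : F →+* ℂ) (V : HermSpace3 F ι₁) (Φ : CMType F)
    (Dμ : (D F ι₁ V Φ).Obj) :
    liuPinFamily h₃ D F ι₁ V Φ Dμ =
      liuPinAV h₃ F ι₁ (D F ι₁ V Φ).cmType (D F ι₁ V Φ).isConjugateSymplectic (Thm418Data.hasCMType_cmType (D F ι₁ V Φ)) := by
  unfold liuPinFamily
  exact dif_pos hG

/-- **The junction's (hCM) binder HOLDS for `Aμ := liuPinFamily h₃ D`** — verbatim in the ∀-guarded ∃-shape of
`Model.faceSupply_of_thm418AsPrinted_pinned` (`Transposition/Item6SupplyPinned.lean`), for EVERY datum family `D`, with NO hypothesis: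
`M := M_μ`, `e := e_μ`, and the realisation from `exists_isCMTypeRealisation_liuPinAV`.  [Liu2021] Def. 4.5 (2) «`i_μ : M_μ → End_E(A_μ)_ℚ` is a
CM structure …» at the tree's own `A_{(M_μ, Ψ̃_μ)}`. [cite: Liu2021, Def. 4.5 (2) and Def. 4.3 (2)] -/
theorem hCM_liuPinFamily (h₃ : CMAbelianVarietyRealised)
    (D : ∀ (F : CMField) (ι₁ : F →+* ℂ) (_ : HermSpace3 F ι₁) (_ : CMType F), Thm418Data (maximalRealSubfield F) F) :
    ∀ (F : CMField) [IsGalois ℚ F], 6 ≤ Module.finrank ℚ F → ∀ (Φ : CMType F) (ι₁ : F →+* ℂ), ι₁ ∈ Φ.1 →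
      ∀ (V : HermSpace3 F ι₁) (Dμ : (D F ι₁ V Φ).Obj),
        ∃ (M : Type) (_ : Field M) (_ : NumberField M) (_ : IsCMField M)
          (e : reflexField ℚ F (algValuedIn ι₁ (D F ι₁ V Φ).cmType.1) →+* M)
          (ιB : 𝓞 M →+* End (liuPinFamily h₃ D F ι₁ V Φ Dμ))
          (θB : M →+* Module.End ℂ (complexBetti (liuPinFamily h₃ D F ι₁ V Φ Dμ).X 1)),
          IsCMTypeRealisation (inducedCMType e (reflexCMType ι₁ (D F ι₁ V Φ).cmType (AlgHom.id ℚ F)))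
            (liuPinFamily h₃ D F ι₁ V Φ Dμ) ιB θB := by
  intro F hG _ Φ ι₁ _ V Dμ
  rw [liuPinFamily_eq h₃ D F ι₁ V Φ Dμ]
  letI : NumberField (muAlgValueField F (D F ι₁ V Φ).μ) := Thm418Data.numberField_muAlgValueField (D F ι₁ V Φ)
  letI : IsCMField (muAlgValueField F (D F ι₁ V Φ).μ) := Thm418Data.isCMField_muAlgValueField (D F ι₁ V Φ)
  obtain ⟨ιB, θB, hB⟩ := exists_isCMTypeRealisation_liuPinAV h₃ F ι₁ (D F ι₁ V Φ).cmType
    (D F ι₁ V Φ).isConjugateSymplectic (Thm418Data.hasCMType_cmType (D F ι₁ V Φ))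
  exact ⟨muAlgValueField F (D F ι₁ V Φ).μ, inferInstance, inferInstance, inferInstance,
    liuPinEmb F ι₁ (D F ι₁ V Φ).cmType (D F ι₁ V Φ).isConjugateSymplectic (Thm418Data.hasCMType_cmType (D F ι₁ V Φ)),
    ιB, θB, hB⟩

/-- **CM-side reach for the family pin**: under the junction's (hμ) clause at `(F, ι₁, V, Φ)` — «the datum's `Φ_μ` is the inverse type of
`Φ` through `ι₁`» — every non-zero `u : X ⟶ liuPinFamily h₃ D F ι₁ V Φ Dμ` yields a non-zero `X ⟶ A_{(F,Φ)}`; compose with (hReach)'s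
`w : 𝒥.J ⟶ Aμ …` to feed `faceSupply_of_albaneseFactor`. [cite: Shimura1998, §6.2 Theorem 3 and §8.3 Prop. 28] [cite: Liu2021, Def. 4.5 (2)] -/
theorem exists_hom_cmAV_ne_zero_of_hom_liuPinFamily (h₃ : CMAbelianVarietyRealised)
    (D : ∀ (F : CMField) (ι₁ : F →+* ℂ) (_ : HermSpace3 F ι₁) (_ : CMType F), Thm418Data (maximalRealSubfield F) F)
    (F : CMField) [IsGalois ℚ F] (ι₁ : F →+* ℂ) (V : HermSpace3 F ι₁)
    (Φ : CMType F) (Dμ : (D F ι₁ V Φ).Obj)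
    (hμ : ∀ g : F ≃ₐ[ℚ] F, ι₁.comp (g : F →+* F) ∈ (D F ι₁ V Φ).cmType.1 ↔ ι₁.comp (g.symm : F →+* F) ∈ Φ.1)
    {X : AbelianVariety ℂ} :
    ∀ {u : X ⟶ liuPinFamily h₃ D F ι₁ V Φ Dμ}, u ≠ 0 → ∃ v : X ⟶ (cmRealisation h₃ (cmCode F Φ)).AV, v ≠ 0 := by
  rw [liuPinFamily_eq h₃ D F ι₁ V Φ Dμ]
  intro u hu
  exact exists_hom_cmAV_ne_zero_of_hom_liuPinAV h₃ F ι₁ (D F ι₁ V Φ).cmType (D F ι₁ V Φ).isConjugateSymplectic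
    (Thm418Data.hasCMType_cmType (D F ι₁ V Φ)) hμ hu

end Family

end Summit.HodgeConjecture.CorCM.Model

end
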